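import Summits.Ventures.PercRepro.C041StarBoundsFour
import Summits.Ventures.PercRepro.C041SeedCoverBox1f
import Summits.Ventures.PercRepro.C041SeedCoverBox2
import Summits.Ventures.PercRepro.C041SeedCoverBox3
import Summits.Ventures.PercRepro.C041SeedCoverBox4
import Summits.Ventures.PercRepro.C041SeedCoverBox5
import Summits.Ventures.PercRepro.C041SeedCoverBox6
import Summits.Ventures.PercRepro.C041SeedCoverBox7
import Summits.Ventures.PercRepro.C041SeedCoverBox8
import Summits.Ventures.PercRepro.C041SeedSlab111
import Summits.Ventures.PercRepro.C041SeedSlab112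
import Summits.Ventures.PercRepro.C041SeedSlab115

/-!
# THE BULK OF THE LOWER-FRONTIER COVER — every star with `A, B ∈ [1/20, 1/2]` (mine-3, gen 64; C-041.md §21 (ay))

The nine boxes of `{[1/20, 3/20], [3/20, 3/10], [3/10, 1/2]}²`: the box with both `A, B ≥ 3/10` holds no star
(`4AB ≤ (1 − A − B)²`); in every other box the box theorem covers `P₁ ∈ [6/5, 9/2]` and a low slab covers
`P₁ ∈ [1, 6/5]` (no lowering needed there: `P₂ ≤ A₀^{-1/2}` from `P₂² A ≤ 1`); `P₁ ≤ 9/2` comes from `P₁² B ≤ 1`.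
THEOREM: every star with `m ≥ 2` leaves in `[0, 1]` whose invariants satisfy `1/20 ≤ A ≤ 1/2` and `1/20 ≤ B ≤ 1/2` has
`θ_△(v 1, V a) ∈ cone` — uniform in `m`, leaves anywhere in `[0, 1]`, no condition on `P₁, P₂`.
-/

namespace PercRepro

namespace RelaxedTriangle

open TreeClosure

/-- `0 ≤ P₂` from `1 + B² ≤ P₂`. -/
theorem bulk_P2_nonneg (P2 B : ℝ) (h2 : 1 + B ^ 2 ≤ P2) : 0 ≤ P2 := by nlinarith [sq_nonneg B]

/-- `P₁ ≤ 9/2` from `P₁² B ≤ 1` and `B ≥ 1/20`. -/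
theorem bulk_P1_le (P1 B : ℝ) (hP0 : 0 ≤ P1) (hB : (1 / 20 : ℝ) ≤ B) (hu1 : P1 ^ 2 * B ≤ 1) : P1 ≤ 9 / 2 := by
  nlinarith [mul_nonneg hP0 hP0, mul_nonneg (mul_nonneg hP0 hP0) (sub_nonneg.2 hB)]

/-- `P₁ ≤ 47/25` from `P₁² B ≤ 1` and `B ≥ 3/10`. -/
theorem bulk_P1_le3 (P1 B : ℝ) (hP0 : 0 ≤ P1) (hB : B ≥ 3 / 10) (hu1 : P1 ^ 2 * B ≤ 1) : P1 ≤ 47 / 25 := by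
  nlinarith [mul_nonneg hP0 hP0, mul_nonneg (mul_nonneg hP0 hP0) (sub_nonneg.2 hB)]

/-- `P₁ ≤ 13/5` from `P₁² B ≤ 1` and `B ≥ 3/20`. -/
theorem bulk_P1_le2 (P1 B : ℝ) (hP0 : 0 ≤ P1) (hB : B ≥ 3 / 20) (hu1 : P1 ^ 2 * B ≤ 1) : P1 ≤ 13 / 5 := by
  nlinarith [mul_nonneg hP0 hP0, mul_nonneg (mul_nonneg hP0 hP0) (sub_nonneg.2 hB)]

/-- No star has both `A, B > 3/10` (from `4AB ≤ (1 − A − B)²`). -/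
theorem bulk_no_corner (A B : ℝ) (hA : A > 3 / 10) (hB : B > 3 / 10) (hA1 : A ≤ 1 / 2) (hB1 : B ≤ 1 / 2)
    (hR2 : 4 * (A * B) ≤ (1 - A - B) ^ 2) : False := by nlinarith

/-- Box of low slab 110: `P₂ ≤ (2241 / 500 : ℝ)` from `P₂² A ≤ 1` and `A ≥ (1 / 20 : ℝ)`. -/
theorem bulk_cap_i_110 (P2 A : ℝ) (hA0 : (1 / 20 : ℝ) ≤ A) (hu2 : P2 ^ 2 * A ≤ 1) (hP2 : 0 ≤ P2) : P2 ≤ (2241 / 500 : ℝ) := by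
  nlinarith [mul_nonneg (sub_nonneg.2 hA0) (sq_nonneg P2), mul_nonneg hP2 hP2]

/-- Box of low slab 110: no star has `P₁ ≤ 6/5` there (the mirror hyperbola exceeds the cap `(2241 / 500 : ℝ)`). -/
theorem bulk_empty_110 (P1 P2 B : ℝ) (_hB0 : 0 ≤ B) (hB1 : B ≤ (3 / 20 : ℝ)) (hP2le : P2 ≤ (2241 / 500 : ℝ)) (hP2 : 0 ≤ P2)
    (hRm : 3 / 2 * (1 - B) ^ 2 ≤ P2 * (P1 - 1)) (hlow : P1 ≤ 6 / 5) : False := by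
  nlinarith [mul_nonneg hP2 (sub_nonneg.2 hlow), mul_nonneg (sub_nonneg.2 hB1) (sub_nonneg.2 hB1), mul_nonneg _hB0 (sub_nonneg.2 hB1)]

/-- Low slab 111: `P₂ ≤ (2241 / 500 : ℝ)` from `P₂² A ≤ 1` and `A ≥ (1 / 20 : ℝ)`. -/
theorem bulk_cap_i_111 (P2 A : ℝ) (hA0 : (1 / 20 : ℝ) ≤ A) (hu2 : P2 ^ 2 * A ≤ 1) (hP2 : 0 ≤ P2) : P2 ≤ (2241 / 500 : ℝ) := by
  nlinarith [mul_nonneg (sub_nonneg.2 hA0) (sq_nonneg P2), mul_nonneg hP2 hP2]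

/-- Low slab 112: `P₂ ≤ (2241 / 500 : ℝ)` from `P₂² A ≤ 1` and `A ≥ (1 / 20 : ℝ)`. -/
theorem bulk_cap_i_112 (P2 A : ℝ) (hA0 : (1 / 20 : ℝ) ≤ A) (hu2 : P2 ^ 2 * A ≤ 1) (hP2 : 0 ≤ P2) : P2 ≤ (2241 / 500 : ℝ) := by
  nlinarith [mul_nonneg (sub_nonneg.2 hA0) (sq_nonneg P2), mul_nonneg hP2 hP2]

/-- Box of low slab 113: `P₂ ≤ (324 / 125 : ℝ)` from `P₂² A ≤ 1` and `A ≥ (3 / 20 : ℝ)`. -/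
theorem bulk_cap_i_113 (P2 A : ℝ) (hA0 : (3 / 20 : ℝ) ≤ A) (hu2 : P2 ^ 2 * A ≤ 1) (hP2 : 0 ≤ P2) : P2 ≤ (324 / 125 : ℝ) := by
  nlinarith [mul_nonneg (sub_nonneg.2 hA0) (sq_nonneg P2), mul_nonneg hP2 hP2]

/-- Box of low slab 113: no star has `P₁ ≤ 6/5` there (the mirror hyperbola exceeds the cap `(324 / 125 : ℝ)`). -/
theorem bulk_empty_113 (P1 P2 B : ℝ) (_hB0 : 0 ≤ B) (hB1 : B ≤ (3 / 20 : ℝ)) (hP2le : P2 ≤ (324 / 125 : ℝ)) (hP2 : 0 ≤ P2)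
    (hRm : 3 / 2 * (1 - B) ^ 2 ≤ P2 * (P1 - 1)) (hlow : P1 ≤ 6 / 5) : False := by
  nlinarith [mul_nonneg hP2 (sub_nonneg.2 hlow), mul_nonneg (sub_nonneg.2 hB1) (sub_nonneg.2 hB1), mul_nonneg _hB0 (sub_nonneg.2 hB1)]

/-- Box of low slab 114: `P₂ ≤ (324 / 125 : ℝ)` from `P₂² A ≤ 1` and `A ≥ (3 / 20 : ℝ)`. -/
theorem bulk_cap_i_114 (P2 A : ℝ) (hA0 : (3 / 20 : ℝ) ≤ A) (hu2 : P2 ^ 2 * A ≤ 1) (hP2 : 0 ≤ P2) : P2 ≤ (324 / 125 : ℝ) := by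
  nlinarith [mul_nonneg (sub_nonneg.2 hA0) (sq_nonneg P2), mul_nonneg hP2 hP2]

/-- Box of low slab 114: no star has `P₁ ≤ 6/5` there (the mirror hyperbola exceeds the cap `(324 / 125 : ℝ)`). -/
theorem bulk_empty_114 (P1 P2 B : ℝ) (_hB0 : 0 ≤ B) (hB1 : B ≤ (3 / 10 : ℝ)) (hP2le : P2 ≤ (324 / 125 : ℝ)) (hP2 : 0 ≤ P2)
    (hRm : 3 / 2 * (1 - B) ^ 2 ≤ P2 * (P1 - 1)) (hlow : P1 ≤ 6 / 5) : False := by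
  nlinarith [mul_nonneg hP2 (sub_nonneg.2 hlow), mul_nonneg (sub_nonneg.2 hB1) (sub_nonneg.2 hB1), mul_nonneg _hB0 (sub_nonneg.2 hB1)]

/-- Low slab 115: `P₂ ≤ (324 / 125 : ℝ)` from `P₂² A ≤ 1` and `A ≥ (3 / 20 : ℝ)`. -/
theorem bulk_cap_i_115 (P2 A : ℝ) (hA0 : (3 / 20 : ℝ) ≤ A) (hu2 : P2 ^ 2 * A ≤ 1) (hP2 : 0 ≤ P2) : P2 ≤ (324 / 125 : ℝ) := by
  nlinarith [mul_nonneg (sub_nonneg.2 hA0) (sq_nonneg P2), mul_nonneg hP2 hP2]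

/-- Box of low slab 116: `P₂ ≤ (459 / 250 : ℝ)` from `P₂² A ≤ 1` and `A ≥ (3 / 10 : ℝ)`. -/
theorem bulk_cap_i_116 (P2 A : ℝ) (hA0 : (3 / 10 : ℝ) ≤ A) (hu2 : P2 ^ 2 * A ≤ 1) (hP2 : 0 ≤ P2) : P2 ≤ (459 / 250 : ℝ) := by
  nlinarith [mul_nonneg (sub_nonneg.2 hA0) (sq_nonneg P2), mul_nonneg hP2 hP2]

/-- Box of low slab 116: no star has `P₁ ≤ 6/5` there (the mirror hyperbola exceeds the cap `(459 / 250 : ℝ)`). -/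
theorem bulk_empty_116 (P1 P2 B : ℝ) (_hB0 : 0 ≤ B) (hB1 : B ≤ (3 / 20 : ℝ)) (hP2le : P2 ≤ (459 / 250 : ℝ)) (hP2 : 0 ≤ P2)
    (hRm : 3 / 2 * (1 - B) ^ 2 ≤ P2 * (P1 - 1)) (hlow : P1 ≤ 6 / 5) : False := by
  nlinarith [mul_nonneg hP2 (sub_nonneg.2 hlow), mul_nonneg (sub_nonneg.2 hB1) (sub_nonneg.2 hB1), mul_nonneg _hB0 (sub_nonneg.2 hB1)]

/-- Box of low slab 117: `P₂ ≤ (459 / 250 : ℝ)` from `P₂² A ≤ 1` and `A ≥ (3 / 10 : ℝ)`. -/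
theorem bulk_cap_i_117 (P2 A : ℝ) (hA0 : (3 / 10 : ℝ) ≤ A) (hu2 : P2 ^ 2 * A ≤ 1) (hP2 : 0 ≤ P2) : P2 ≤ (459 / 250 : ℝ) := by
  nlinarith [mul_nonneg (sub_nonneg.2 hA0) (sq_nonneg P2), mul_nonneg hP2 hP2]

/-- Box of low slab 117: no star has `P₁ ≤ 6/5` there (the mirror hyperbola exceeds the cap `(459 / 250 : ℝ)`). -/
theorem bulk_empty_117 (P1 P2 B : ℝ) (_hB0 : 0 ≤ B) (hB1 : B ≤ (3 / 10 : ℝ)) (hP2le : P2 ≤ (459 / 250 : ℝ)) (hP2 : 0 ≤ P2)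
    (hRm : 3 / 2 * (1 - B) ^ 2 ≤ P2 * (P1 - 1)) (hlow : P1 ≤ 6 / 5) : False := by
  nlinarith [mul_nonneg hP2 (sub_nonneg.2 hlow), mul_nonneg (sub_nonneg.2 hB1) (sub_nonneg.2 hB1), mul_nonneg _hB0 (sub_nonneg.2 hB1)]

/-- **THE SEED ON THE BULK OF THE INVARIANTS**: `A, B ∈ [1/20, 1/2]`, every `m ≥ 2`. -/
theorem InCone_thetaTri_v1_V_bulk {m : ℕ} (a : Fin (m + 2) → ℝ) (ha : ∀ i, 0 ≤ a i ∧ a i ≤ 1)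
    (hA : (1 / 20 : ℝ) ≤ ∏ i, a i ∧ ∏ i, a i ≤ 1 / 2) (hB : (1 / 20 : ℝ) ≤ ∏ i, (1 - a i) ∧ ∏ i, (1 - a i) ≤ 1 / 2) :
    InCone (thetaTri (v 1) (V a)) := by
  have h1 := one_add_prod_sq_le a ha
  have h2 := one_add_prod_one_sub_sq_le a ha
  have h4A := four_mul_prod_le_prod_one_add_sq a ha
  have h4B := four_mul_prod_one_sub_le_prod a ha
  have hR := sharp_R a ha
  have hRm := sharp_R_mirror a ha
  have hU := U_ineq a ha
  have hu1 := prod_one_add_sq_sq_mul_prod_one_sub_le_one a ha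
  have hu2 := prod_one_add_one_sub_sq_sq_mul_prod_le_one a ha
  have hR2 := four_mul_prod_mul_prod_one_sub_le a ha
  have hP1one := one_le_prod_one_add_sq a
  set P1 := ∏ i, (1 + a i ^ 2) with hP1d
  set P2 := ∏ i, (1 + (1 - a i) ^ 2) with hP2d
  set A := ∏ i, a i with hAd
  set B := ∏ i, (1 - a i) with hBd
  have hP0 : (0 : ℝ) ≤ P1 := by linarith
  have hP2nn : (0 : ℝ) ≤ P2 := bulk_P2_nonneg P2 B h2
  obtain ⟨hB00, _⟩ := prod_unit_mem (fun i => 1 - a i) (fun i => ⟨by linarith [(ha i).2], by linarith [(ha i).1]⟩)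
  have hP1u : P1 ≤ 9 / 2 := bulk_P1_le P1 B hP0 hB.1 hu1
  have hP1B3 : B ≥ 3 / 10 → P1 ≤ 47 / 25 := fun h => bulk_P1_le3 P1 B hP0 h hu1
  have hP1B2 : B ≥ 3 / 20 → P1 ≤ 13 / 5 := fun h => bulk_P1_le2 P1 B hP0 h hu1
  rcases le_or_gt A (3 / 20) with hA1 | hA1
  · rcases le_or_gt B (3 / 20) with hB1 | hB1
    · rcases le_or_gt P1 (6 / 5 : ℝ) with hlow | hlow
      · exact (bulk_empty_110 P1 P2 B hB00 hB1 (bulk_cap_i_110 P2 A hA.1 hu2 hP2nn) hP2nn hRm hlow).elim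
      · exact InCone_thetaTri_v1_V_box1f a ha ⟨hA.1, hA1⟩ ⟨hB.1, hB1⟩ ⟨hlow.le, hP1u⟩
    · rcases le_or_gt B (3 / 10) with hB2 | hB2
      · rcases le_or_gt P1 (6 / 5 : ℝ) with hlow | hlow
        · have hcap : P2 ≤ (2241 / 500 : ℝ) := bulk_cap_i_111 P2 A hA.1 hu2 hP2nn
          exact InCone_thetaTri_v1_V_of_le a le_rfl le_rfl (InCone_thetaTri_v1_slab111 P1 P2 A B hA.1 hA1 hB1.le hB2 hP1one hlow hcap h1 h2 h4A h4B hR hRm hU hu1 hu2)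
        · exact InCone_thetaTri_v1_V_box2 a ha ⟨hA.1, hA1⟩ ⟨hB1.le, hB2⟩ ⟨hlow.le, hP1B2 hB1.le⟩
      · rcases le_or_gt P1 (6 / 5 : ℝ) with hlow | hlow
        · have hcap : P2 ≤ (2241 / 500 : ℝ) := bulk_cap_i_112 P2 A hA.1 hu2 hP2nn
          exact InCone_thetaTri_v1_V_of_le a le_rfl le_rfl (InCone_thetaTri_v1_slab112 P1 P2 A B hA.1 hA1 hB2.le hB.2 hP1one hlow hcap h1 h2 h4A h4B hR hRm hU hu1 hu2)
        · exact InCone_thetaTri_v1_V_box3 a ha ⟨hA.1, hA1⟩ ⟨hB2.le, hB.2⟩ ⟨hlow.le, hP1B3 hB2.le⟩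
  · rcases le_or_gt A (3 / 10) with hA2 | hA2
    · rcases le_or_gt B (3 / 20) with hB1 | hB1
      · rcases le_or_gt P1 (6 / 5 : ℝ) with hlow | hlow
        · exact (bulk_empty_113 P1 P2 B hB00 hB1 (bulk_cap_i_113 P2 A hA1.le hu2 hP2nn) hP2nn hRm hlow).elim
        · exact InCone_thetaTri_v1_V_box4 a ha ⟨hA1.le, hA2⟩ ⟨hB.1, hB1⟩ ⟨hlow.le, hP1u⟩
      · rcases le_or_gt B (3 / 10) with hB2 | hB2
        · rcases le_or_gt P1 (6 / 5 : ℝ) with hlow | hlow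
          · exact (bulk_empty_114 P1 P2 B hB00 hB2 (bulk_cap_i_114 P2 A hA1.le hu2 hP2nn) hP2nn hRm hlow).elim
          · exact InCone_thetaTri_v1_V_box5 a ha ⟨hA1.le, hA2⟩ ⟨hB1.le, hB2⟩ ⟨hlow.le, hP1B2 hB1.le⟩
        · rcases le_or_gt P1 (6 / 5 : ℝ) with hlow | hlow
          · have hcap : P2 ≤ (324 / 125 : ℝ) := bulk_cap_i_115 P2 A hA1.le hu2 hP2nn
            exact InCone_thetaTri_v1_V_of_le a le_rfl le_rfl (InCone_thetaTri_v1_slab115 P1 P2 A B hA1.le hA2 hB2.le hB.2 hP1one hlow hcap h1 h2 h4A h4B hR hRm hU hu1 hu2)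
          · exact InCone_thetaTri_v1_V_box6 a ha ⟨hA1.le, hA2⟩ ⟨hB2.le, hB.2⟩ ⟨hlow.le, hP1B3 hB2.le⟩
    · rcases le_or_gt B (3 / 20) with hB1 | hB1
      · rcases le_or_gt P1 (6 / 5 : ℝ) with hlow | hlow
        · exact (bulk_empty_116 P1 P2 B hB00 hB1 (bulk_cap_i_116 P2 A hA2.le hu2 hP2nn) hP2nn hRm hlow).elim
        · exact InCone_thetaTri_v1_V_box7 a ha ⟨hA2.le, hA.2⟩ ⟨hB.1, hB1⟩ ⟨hlow.le, hP1u⟩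
      · rcases le_or_gt B (3 / 10) with hB2 | hB2
        · rcases le_or_gt P1 (6 / 5 : ℝ) with hlow | hlow
          · exact (bulk_empty_117 P1 P2 B hB00 hB2 (bulk_cap_i_117 P2 A hA2.le hu2 hP2nn) hP2nn hRm hlow).elim
          · exact InCone_thetaTri_v1_V_box8 a ha ⟨hA2.le, hA.2⟩ ⟨hB1.le, hB2⟩ ⟨hlow.le, hP1B2 hB1.le⟩
        · exact (bulk_no_corner A B hA2 hB2 hA.2 hB.2 hR2).elim

end RelaxedTriangle

end PercRepro
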